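import Mathlib
import Summits.KontsevichZagierPeriods.KontsevichZagierPeriods.Theorems.SoloInformedHarmonicGQ
import HarnessLib
import HarnessLib.Audit

/-!
# SoloInformed — the tail step of the hook identities (divided difference of a chain function)

Solo programme `solo-KontsevichZagierPeriods-informed`, session s50 (PROGRAMME LIII, file F1a).

The `B`-side of an ITERATED scale band step (`SoloInformedScaleDatum.scale`) acts on a cube
integrand that is a sum of chain functions `G(L)` (`soloInformedGQ`), the active variable occurring
exactly in a TAIL `T` of each list `L = H ++ T`.  Scaling the active variable by `Y` multiplies the
tail by `Y`, and the divided difference is again a sum of chain functions, by the `p = 0` case of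
the deformed harmonic-product identity `soloInformed_harmonicGQ_aux`:

  `G(H ++ T) − Y·G(H ++ T·Y) = (1 − Y)·( Σ_{s=1}^{|T|} G(H ++ ins_s(Y;T)) + Σ_{s<|T|} G(H ++ merge_s(Y;T)) )`

(`soloInformed_hookTail`, `soloInformed_hookTail_succ`).  Read on words, `ins_s` inserts a new letter
`1` after block `s` of the tail and `merge_s` raises block `s` by one: iterating from the top
chain of `ζ(u)` with `i` hanging variables enumerates Kaneko–Yamamoto's index set
`u ⊛ (1,…,1)^★` of the integral–series identity for the hook shapes (THEOREM L is `i = 1`).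

References: M. Kaneko, S. Yamamoto, arXiv:1605.03117, Thm 4.1, Prop. 5.4; M. Hoffman, J. Algebra 194
(1997) §2; Kontsevich–Zagier 2001 §1.2 [KontsevichZagier2001].
-/

noncomputable section

namespace Summit.KontsevichZagierPeriods.KontsevichZagierPeriods.Theorems

/-- Head factorisation: `G(H ++ L) = (∏_{a ∈ H} a/(1−a)) · G(L)` for a nonempty tail `L`. -/
theorem soloInformedGQ_append {L : List ℝ} (hL : L ≠ []) (H : List ℝ) :
    soloInformedGQ (H ++ L) = (H.map fun a => a / (1 - a)).prod * soloInformedGQ L := by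
  induction H with
  | nil => simp
  | cons a H ih =>
    have hne : H ++ L ≠ [] := by simp [hL]
    rw [List.cons_append, soloInformedGQ_cons hne a, ih, List.map_cons, List.prod_cons, mul_assoc]

/-- A chain function with a vanishing non-final entry vanishes: `G(0 :: L) = 0` (`L ≠ []`). -/
theorem soloInformedGQ_zero_cons {L : List ℝ} (hL : L ≠ []) : soloInformedGQ (0 :: L) = 0 := by
  rw [soloInformedGQ_cons hL]
  simp

/-- The `s = 0` insertion with empty-prefix value `0` contributes nothing:
`G(H ++ ins_0^{(0)}(Y;T)) = 0` for `T ≠ []`. -/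
theorem soloInformedGQ_append_insQ_zero (Y : ℝ) (H : List ℝ) {T : List ℝ} (hT : T ≠ []) :
    soloInformedGQ (H ++ soloInformedInsQ Y 0 T 0) = 0 := by
  have hmap : T.map (· * Y) ≠ [] := by simpa using hT
  rw [soloInformedInsQ_zero, zero_mul, soloInformedGQ_append (by simp) H,
    soloInformedGQ_zero_cons hmap, mul_zero]

/-- **THE TAIL STEP (divided difference of a chain function along its tail).**  For `0 ≤ Y < 1`,
a head `H` and a nonempty tail `T` with entries in `[0,1)`:
`G(H ++ T) − Y·G(H ++ T·Y) = (1 − Y)·(Σ_{s ≤ |T|} G(H ++ ins_s^{(0)}(Y;T)) + Σ_{s<|T|} G(H ++ merge_s(Y;T)))`.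
[`p = 0` case of `soloInformed_harmonicGQ_aux`, head factored by `soloInformedGQ_append`] -/
theorem soloInformed_hookTail {Y : ℝ} (hY : 0 ≤ Y ∧ Y < 1) (H : List ℝ) {T : List ℝ} (hT : T ≠ [])
    (hT' : ∀ q ∈ T, 0 ≤ q ∧ q < 1) :
    soloInformedGQ (H ++ T) - Y * soloInformedGQ (H ++ T.map (· * Y)) =
      (1 - Y) * ((∑ s ∈ Finset.range (T.length + 1), soloInformedGQ (H ++ soloInformedInsQ Y 0 T s)) +
        ∑ s ∈ Finset.range T.length, soloInformedGQ (H ++ soloInformedMergeQ Y T s)) := by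
  have hmap : T.map (· * Y) ≠ [] := by simpa using hT
  have key := soloInformed_harmonicGQ_aux hY T 0 hT' le_rfl zero_le_one
  have e1 : ∑ s ∈ Finset.range (T.length + 1), soloInformedGQ (H ++ soloInformedInsQ Y 0 T s) =
      (H.map fun a => a / (1 - a)).prod *
        ∑ s ∈ Finset.range (T.length + 1), soloInformedGQ (soloInformedInsQ Y 0 T s) := by
    rw [Finset.mul_sum]
    exact Finset.sum_congr rfl fun s _ => soloInformedGQ_append (soloInformedInsQ_ne_nil Y 0 T s) H
  have e2 : ∑ s ∈ Finset.range T.length, soloInformedGQ (H ++ soloInformedMergeQ Y T s) =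
      (H.map fun a => a / (1 - a)).prod *
        ∑ s ∈ Finset.range T.length, soloInformedGQ (soloInformedMergeQ Y T s) := by
    rw [Finset.mul_sum]
    exact Finset.sum_congr rfl fun s _ => soloInformedGQ_append (soloInformedMergeQ_ne_nil Y hT s) H
  rw [e1, e2, soloInformedGQ_append hT H, soloInformedGQ_append hmap H, ← mul_add, key]
  have h1 : 1 - Y ≠ 0 := by linarith [hY.2]
  simp only [zero_mul, sub_zero, zero_div, zero_sub]
  field_simp
  ring

/-- **The tail step with the vanishing term removed:**
`G(H ++ T) − Y·G(H ++ T·Y) = (1 − Y)·(Σ_{s<|T|} G(H ++ ins_{s+1}(Y;T)) + Σ_{s<|T|} G(H ++ merge_s(Y;T)))`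
— one new letter after block `s + 1` of the tail, or block `s` of the tail raised by one. -/
theorem soloInformed_hookTail_succ {Y : ℝ} (hY : 0 ≤ Y ∧ Y < 1) (H : List ℝ) {T : List ℝ}
    (hT : T ≠ []) (hT' : ∀ q ∈ T, 0 ≤ q ∧ q < 1) :
    soloInformedGQ (H ++ T) - Y * soloInformedGQ (H ++ T.map (· * Y)) =
      (1 - Y) * ((∑ s ∈ Finset.range T.length, soloInformedGQ (H ++ soloInformedInsQ Y 0 T (s + 1))) +
        ∑ s ∈ Finset.range T.length, soloInformedGQ (H ++ soloInformedMergeQ Y T s)) := by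
  rw [soloInformed_hookTail hY H hT hT', Finset.sum_range_succ', soloInformedGQ_append_insQ_zero Y H hT,
    add_zero]

/-- **The divided-difference form** used by the scale band step (`f_B = (Φ − YΦ(·Y))/(C(1 − Y))`):
`(G(H ++ T) − Y·G(H ++ T·Y))/(C(1 − Y)) = (Σ_{s<|T|} G(H ++ ins_{s+1}) + Σ_{s<|T|} G(H ++ merge_s))/C`. -/
theorem soloInformed_hookTail_div {Y : ℝ} (hY : 0 ≤ Y ∧ Y < 1) (H : List ℝ) {T : List ℝ}
    (hT : T ≠ []) (hT' : ∀ q ∈ T, 0 ≤ q ∧ q < 1) (C : ℝ) :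
    (soloInformedGQ (H ++ T) - Y * soloInformedGQ (H ++ T.map (· * Y))) / (C * (1 - Y)) =
      ((∑ s ∈ Finset.range T.length, soloInformedGQ (H ++ soloInformedInsQ Y 0 T (s + 1))) +
        ∑ s ∈ Finset.range T.length, soloInformedGQ (H ++ soloInformedMergeQ Y T s)) / C := by
  rw [soloInformed_hookTail_succ hY H hT hT']
  have h1 : 1 - Y ≠ 0 := by linarith [hY.2]
  rw [mul_comm C, mul_div_mul_left _ _ h1]

/-! ## Sanity check: `T = [q]` (one block in the tail) -/

/-- For a one-block tail: `G(H ++ [q]) − Y G(H ++ [qY]) = (1 − Y)(G(H ++ [q, qY]) + G(H ++ [qY]))`. -/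
example {Y : ℝ} (hY : 0 ≤ Y ∧ Y < 1) (H : List ℝ) (q : ℝ) (hq : 0 ≤ q ∧ q < 1) :
    soloInformedGQ (H ++ [q]) - Y * soloInformedGQ (H ++ [q * Y]) =
      (1 - Y) * (soloInformedGQ (H ++ [q, q * Y]) + soloInformedGQ (H ++ [q * Y])) := by
  have h := soloInformed_hookTail_succ hY H (T := [q]) (by simp) (by simpa using hq)
  simpa using h

end Summit.KontsevichZagierPeriods.KontsevichZagierPeriods.Theorems
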